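import Mathlib
import HarnessLib
import HarnessLib.Audit
import Summits.SmoothPoincare4.Statement
import HarnessLib.Audit.Status.Attr

/-!
Route: WrinkleUnlinking

DORMANT since 2026-08-22T19:47:57Z (reconciler: no traction for 5.6 d (last activity item-evidence-added at 2026-08-17T04:30:35Z); parked, not closed — `ledger route dormant route-SmoothPoincare4-WrinkleUnlinking --off` to reactivate) — unstaffed, not closed; items shared with open routes are served there. `ledger route dormant <id> --off` reactivates.

# Route WrinkleUnlinking — Unlink the wrinkles of one degree-one map Σ → S⁴ — lens depth ≤ 2 as the
first rungs, Cerf–Palais as recogniser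

Realises idea card wrinkle-unlinking (S⁴-target half only; its ℝ³ arena is card
fold-walls-circle-chambers). Call p : Σ → S⁴ a DEGREE-ONE WRINKLED MAP with k wrinkles (predicate
IsW S p k D, spelled out verbatim inside every item) if p is smooth, a local diffeomorphism off k
pairwise disjoint closed discs D_i ⊂ Σ, equivalent near each D_i through charts of source and target
to the standard equidimensional wrinkle w(y,z) = (y, z³ + 3(|y|²−1)z) of EliashbergMishachev1997 §1
near the closed unit ball, with exactly one preimage over every point outside the lens images L_i =
p(D_i) and some such point existing. Its DEPTH is the largest number of lens images through one
point of S⁴. Here Σ ranges over exactly the binders of SmoothPoincare4 — any Hausdorff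
second-countable M : Type with a C^∞ atlas on ℝ⁴ and a homotopy equivalence M ≃ₕ S⁴ (compactness and
orientability are consequences, not hypotheses; no Literature structure is imported).
It suffices to show X = X1 ∧ X2: (X1 = DepthTwoRung) every homotopy 4-sphere admitting a degree-one
wrinkled map of depth ≤ 2 is diffeomorphic to S⁴; (X2 = DepthTwoCollapse) every homotopy 4-sphere
admits a degree-one wrinkled map of depth ≤ 2. TwoWrinkleRung (k ≤ 2) is the finite-looking special
case of X1 and is carried as the rank-2 crux. SPC4 ⇒ X (identity map, k = 0), so X ⇔ SPC4: a split
into a low-complexity RECOGNITION statement and a COMPLEXITY-COLLAPSE statement for a new complexity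
(lens depth of one smooth map).
Lean: `(∀ (M : Type) [TopologicalSpace M] [T2Space M] [SecondCountableTopology M] [ChartedSpace
(EuclideanSpace ℝ (Fin 4)) M] [IsManifold (𝓡 4) ∞ M], (M ≃ₕ Metric.sphere (0 : EuclideanSpace ℝ (Fin
5)) 1) → ∀ (p : M → Metric.sphere (0 : EuclideanSpace ℝ (Fin 5)) 1) (k : ℕ) (D : Fin k → Set M),
(ContMDiff (𝓡 4) (𝓡 4) ∞ p ∧ Pairwise (Function.onFun Disjoint D) ∧ (∀ x, x ∉ (⋃ i, D i) →
IsLocalDiffeomorphAt (𝓡 4) (𝓡 4) ∞ p x) ∧ (∀ y, y ∉ (⋃ i, p '' (D i)) → ∃! x, p x = y) ∧ (∃ y, y ∉ ⋃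
i, p '' (D i)) ∧ ∀ i, ∃ (U : Set M) (φ : M → EuclideanSpace ℝ (Fin 4)) (V : Set (Metric.sphere (0 :
EuclideanSpace ℝ (Fin 5)) 1)) (ψ : (Metric.sphere (0 : EuclideanSpace ℝ (Fin 5)) 1) → EuclideanSpace
ℝ (Fin 4)), IsOpen U ∧ D i ⊆ U ∧ Set.InjOn φ U ∧ (∀ x ∈ U, IsLocalDiffeomorphAt (𝓡 4) (𝓡 4) ∞ φ x) ∧
φ '' (D i) = Metric.closedBall (0 : EuclideanSpace ℝ (Fin 4)) 1 ∧ IsOpen V ∧ p '' U ⊆ V ∧ Set.InjOn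
ψ V ∧ (∀ y ∈ V, IsLocalDiffeomorphAt (𝓡 4) (𝓡 4) ∞ ψ y) ∧ ∀ x ∈ U, ψ (p x) = WithLp.toLp 2 (fun j :
Fin 4 => if j = 3 then (φ x 3) ^ 3 + 3 * ((φ x 0) ^ 2 + (φ x 1) ^ 2 + (φ x 2) ^ 2 - 1) * φ x 3 else
φ x j)) → (∀ (y : Metric.sphere (0 : EuclideanSpace ℝ (Fin 5)) 1) (i j l : Fin k), i ≠ j → j ≠ l → i
≠ l → ¬ (y ∈ p '' (D i) ∧ y ∈ p '' (D j) ∧ y ∈ p '' (D l))) → Nonempty (M ≃ₘ⟮𝓡 4, 𝓡 4⟯ Metric.sphere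
(0 : EuclideanSpace ℝ (Fin 5)) 1)) ∧ (∀ (M : Type) [TopologicalSpace M] [T2Space M]
[SecondCountableTopology M] [ChartedSpace (EuclideanSpace ℝ (Fin 4)) M] [IsManifold (𝓡 4) ∞ M], (M
≃ₕ Metric.sphere (0 : EuclideanSpace ℝ (Fin 5)) 1) → ∃ (p : M → Metric.sphere (0 : EuclideanSpace ℝ
(Fin 5)) 1) (k : ℕ) (D : Fin k → Set M), (ContMDiff (𝓡 4) (𝓡 4) ∞ p ∧ Pairwise (Function.onFun
Disjoint D) ∧ (∀ x, x ∉ (⋃ i, D i) → IsLocalDiffeomorphAt (𝓡 4) (𝓡 4) ∞ p x) ∧ (∀ y, y ∉ (⋃ i, p ''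
(D i)) → ∃! x, p x = y) ∧ (∃ y, y ∉ ⋃ i, p '' (D i)) ∧ ∀ i, ∃ (U : Set M) (φ : M → EuclideanSpace ℝ
(Fin 4)) (V : Set (Metric.sphere (0 : EuclideanSpace ℝ (Fin 5)) 1)) (ψ : (Metric.sphere (0 :
EuclideanSpace ℝ (Fin 5)) 1) → EuclideanSpace ℝ (Fin 4)), IsOpen U ∧ D i ⊆ U ∧ Set.InjOn φ U ∧ (∀ x
∈ U, IsLocalDiffeomorphAt (𝓡 4) (𝓡 4) ∞ φ x) ∧ φ '' (D i) = Metric.closedBall (0 : EuclideanSpace ℝ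
(Fin 4)) 1 ∧ IsOpen V ∧ p '' U ⊆ V ∧ Set.InjOn ψ V ∧ (∀ y ∈ V, IsLocalDiffeomorphAt (𝓡 4) (𝓡 4) ∞ ψ
y) ∧ ∀ x ∈ U, ψ (p x) = WithLp.toLp 2 (fun j : Fin 4 => if j = 3 then (φ x 3) ^ 3 + 3 * ((φ x 0) ^ 2
+ (φ x 1) ^ 2 + (φ x 2) ^ 2 - 1) * φ x 3 else φ x j)) ∧ (∀ (y : Metric.sphere (0 : EuclideanSpace ℝ
(Fin 5)) 1) (i j l : Fin k), i ≠ j → j ≠ l → i ≠ l → ¬ (y ∈ p '' (D i) ∧ y ∈ p '' (D j) ∧ y ∈ p ''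
(D l))))`

## Assembly
Pure logic, no vendored fact: given the binders of SmoothPoincare4 (M, its atlas, e : M ≃ₕ S⁴),
DepthTwoCollapse supplies (p, k, D) of depth ≤ 2 on M and DepthTwoRung turns it into the
diffeomorphism M ≅ S⁴ — the deciding theorem `theorem closes (hR : DepthTwoRung) (hC :
DepthTwoCollapse) : SmoothPoincare4` (3 tactic lines, certified by the gate audit). TwoWrinkleRung
is implied by DepthTwoRung (k ≤ 2 leaves no three pairwise distinct indices;
`twoWrinkleRung_of_depthTwoRung` in the planner sketch) and is deliberately NOT a hypothesis of
`closes`; the optional item `Assembly` (TwoWrinkleRung → DepthTwoRung → DepthTwoCollapse →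
SmoothPoincare4) follows from `closes` in one line.

Rationale: WHY THIS LINE. Existence is free and flexible, recognition rigid and cheap. By
EliashbergMishachev1997 (Thm "Wrinkled mappings", restated as Thm 4.4 in arXiv:1108.1265) any
degree-one p : Σ → S⁴ — covered by a bundle isomorphism TΣ ≅ p*TS⁴ since e = 2, p₁ = 0 on both — is
C⁰-approximated by a wrinkled map, so every homotopy 4-sphere is finitely presented by ONE smooth
map whose singular set is k standard cusped 3-spheres, and exoticness lives only in how the k lens
images overlap (imports: singularity theory / h-principle; covering-space recognition). The
UNLINKING LEMMA (support) is elementary: depth ≤ 1 ⇒ one sheet over the complement and a full model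
packet p⁻¹(N_i) ≅ w⁻¹(ball) ≅ B⁴ over a CHART ball N_i around each lens, so Palais
(palais_ballComplement_sphere_four, proved in tree) and Cerf (cerf_twistedSphere_four) give Σ ≅ S⁴.
Design point found while scoping: the cuspless variant is KNOWN to exist — SaekiSakuma1999 Thm 2.1 /
Rem 2.2 (read in BruceMond1999 pp.334–336): p₁ = w₂ = 0 ⇒ every degree Σ → S⁴ contains a pure FOLD
map, via Eliashberg1970 — but its recognition step meets the smooth 4-d Schoenflies problem (fold
images are arbitrary smooth S³ ⊂ S⁴), whereas the E–M normal form carries target charts, so lenses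
are framed and Schoenflies never enters the base case: the cusps buy the framing. Engine for provers
(lemmas ride with --supports): a CLEAN wrinkle — one whose three-layer packet closes up to the full
model without meeting another fold sphere — shrinks to an embryo and cancels, or slides along its
sheet; hence a minimal presentation of an exotic Σ has every wrinkle invaded by another (clasp
cycles), and the first non-trivial configuration is one clasped pair. No prior route or negative
(index empty) uses maps Σ → S⁴ or singularities of maps.

RANKED CRUXES. #2 TwoWrinkleRung (crux) — a homotopy 4-sphere carrying a degree-one wrinkled map to
S⁴ with at most two wrinkles is diffeomorphic to S⁴ (card rung "two overlapping wrinkles ⇒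
standard"; by the parking argument it reduces to one clasped pair over the cells of two overlapping
cusped 3-spheres in S⁴). [deps: UnlinkingLemma] [difficulty: XL] (why it might fail: overlap cells
of two chart balls in S⁴ can be Schoenflies-type fake balls or encode a Gluck twist, so the
clasped-pair case may be as hard as those problems; no finite census of two-lens arrangements
exists.) [EliashbergMishachev1997, Cerf1968, Palais1960]
#3 DepthTwoRung (crux) — a homotopy 4-sphere carrying a degree-one wrinkled map to S⁴ of lens depth
≤ 2 (no point of S⁴ in three lens images) is diffeomorphic to S⁴; implies TwoWrinkleRung (proved in
the sketch). [deps: TwoWrinkleRung] [difficulty: open-problem] (why it might fail: depth 2 allows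
necklaces of pairwise clasped wrinkles around loops in S⁴, which may realise spun / twist-spun
(Gluck) presentations; pairwise analysis need not globalise.) [EliashbergMishachev1997,
SaekiSakuma1999, Cerf1968]
#4 DepthTwoCollapse (crux) — every homotopy 4-sphere admits a degree-one wrinkled map to S⁴ of lens
depth ≤ 2 (the complexity-collapse half; weaker than "≤ 2 wrinkles"). [difficulty: open-problem]
(why it might fail: no operation lowering depth is known (wrinkling raises complexity; parking only
separates clean wrinkles); minimal depth may be ≥ 3 or unbounded on exotic spheres; evidence beyond
SPC4 ⇒ it is nil.) [EliashbergMishachev1997, SaekiSakuma1999, Eliashberg1970]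
#9 UnlinkingLemma (support) — depth ≤ 1 (lens images pairwise disjoint) ⇒ Σ ≅ S⁴: one sheet over the
complement of the lenses, full model packet ≅ B⁴ over a chart ball around each lens, Palais
(palais_ballComplement_sphere_four) + Cerf (cerf_twistedSphere_four as hypothesis if needed). The
base case of the ladder; implies the k ≤ 1 case of TwoWrinkleRung (proved in the sketch).
[difficulty: L] [EliashbergMishachev1997, Palais1960, Cerf1968]
#9 WrinkledExistence (support) — every homotopy 4-sphere admits a degree-one wrinkled map to S⁴
(some k). CLAIM resting on EliashbergMishachev1997 Thm "Wrinkled mappings" + Dold–Whitney (TΣ ≅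
p*TS⁴) + the degree bookkeeping (Σ minus the discs is connected, so all sheets over a depth-0 point
have one sign); documents that the arena is non-empty; provable once that theorem is vendored as a
named fact (cite item filed) — until then not staffed. [difficulty: XL] [EliashbergMishachev1997,
SaekiSakuma1999]
#9 OneWrinkleOnSphere (support) — sanity / non-vacuity of the inlined predicate for k = 1: the
standard S⁴ carries a degree-one wrinkled self-map with exactly one wrinkle (cut the polynomial
model w off to the identity far out and transport by stereographic charts). A refuter who cannot
build it has found a definition leak. [difficulty: provable-now] [EliashbergMishachev1997]

TWO-LAYER PLAN. Foreseen after staffing, not filed: TwoWrinkleRung ⇐ CleanCaseRung (two wrinkles,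
one clean ⇒ S⁴: parking + UnlinkingLemma; provable-sized) → ClaspRung (mutually invaded pair ⇒ S⁴) →
TwoWrinkleRung. DepthTwoRung ⇐ TwoWrinkleRung → NecklaceRung (cycles of pairwise clasps) →
DepthTwoRung. DepthTwoCollapse ⇐ WrinkledExistence → DepthReduction (any degree-one wrinkled map is
wrinkled-homotopic, with embryo births/deaths, to one of depth ≤ 2) → DepthTwoCollapse.

KILL CRITERIA. (a) DepthTwoRung or TwoWrinkleRung refuted by an explicit low-depth presentation of a
Σ not diffeomorphic to S⁴ = ¬SPC4: decisive, close refuted. (b) TwoWrinkleRung shown to CONTAIN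
smooth Schoenflies or the Gluck conjecture as a sub-case with no extra structure: demote (merge
staffing into SchoenfliesSplit / GluckLasagna), keep the supports. (c) A refuter satisfies the
inlined predicate with data on which the sheet count fails (definition leak): repair by --restate,
not fatal. (d) The parking lemma fails (clean wrinkles not cancellable inside the class): the ladder
has no engine — close exhausted with census. (e) WrinkledExistence refuted (the predicate is
unsatisfiable for k ≥ 1 on some Σ): restate the predicate; if unrepairable, close.

NOT DECOMPOSED YET. No cell-by-cell census of two-lens arrangements; no front items (Σ ⊂ S⁴×ℝ with
height order and "threading" of pleats): EliashbergMishachev2009 Thm "Embeddings into foliations"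
yields only GENERALIZED (nested) wrinkles for hypersurface fronts, so that refinement stays in NOTES
until TwoWrinkleRung is staffed; no ℝ³-target items (card fold-walls-circle-chambers); no
Gluck-family calibration ("every Gluck twist has depth ≤ 2"); no negative-side item.

CHEAPEST FALSIFIER. (1) Definition: try to satisfy IsW on the standard S⁴ with k = 2 and lenses
covering S⁴ minus a small ball while violating degree one — the clause "some point outside all lens
images, unique preimages there" should block it; and build OneWrinkleOnSphere (if impossible, the
predicate leaks). (2) Literature: SaekiSakuma1999 §3 "Topology of Morin maps" (paywalled here,
acq-02285) or a sequel may already bound or compute the minimal complexity of degree-one fold/cusp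
maps Σ⁴ → S⁴ — a lookup. (3) Mathematics: exhibit on S⁴ a 2-wrinkle degree-one map whose wrinkles
are mutually unclean (a clasp) with an overlap cell that is not a ball — shows rung 2 carries
Schoenflies-type content (demotes, does not kill). I ran (1) informally: lens-covering maps are
excluded by the extra clause; not run in Lean.

NUMBERS. Θ₄ = 0 (KervaireMilnor1963); sheets over a point of depth d: 1 + 2d (d + 1 positive, d
negative); depth ≤ 1 ⇒ standard (UnlinkingLemma); S_r codimension r² for maps 4 → 4, so generic maps
have isolated Σ² points and Morin strata of dimensions 3,2,1,0 — all removed by wrinkling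
(SaekiSakuma1999 Thm 2.1: fold+cusp iff σ = 0).

DEFINITION REQUESTS. IsWrinkledMap / stdWrinkle (Eliashberg–Mishachev wrinkled map M⁴ → N⁴ with
listed discs; topic Literature/Topology/FourManifolds) — to replace the ~900-character inlined
predicate by a named one (then restate items definitionally); cite facts: EliashbergMishachev1997
Thm "Wrinkled mappings"; SaekiSakuma1999 Thm 2.1 / Rem 2.2.

Novelty: Searches (2026-08-15): Searched 2026-08-15: zbMATH 'wrinkling of smooth mappings Eliashberg
Mishachev' (EM97/II/III, S-immersions), 'wrinkled embeddings' (arXiv:1108.1265 READ: defs 4.1–4.6,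
Thms 4.4–4.5, §3 B), 'stable maps between 4-manifolds elimination' (SaekiSakuma1999; survey READ in
held BruceMond1999 pp.330–346), 'wrinkled map homotopy sphere' (0), 'fold map degree one homotopy
sphere' (0 relevant), 'Morin maps 4-manifolds cusps folds' (0), 'fold maps of 4-manifolds into
4-space' (Saeki 2003 = ℝ³ target; Kamenosono–Yamamoto 2009 / Fukuda–Yamamoto 2011 = minimal
singularities of stable maps between SURFACES, the 2-d analogue of wr), 'cobordism of fold maps
4-manifolds' (Kalmár arXiv:0802.0332, ℝ³), lit vsearch (held corpus: Kirby1989, GordonKirby1984,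
FreedmanQuinn, BruceMond1999 — nothing on equidimensional wrinkles vs SPC4), lit frontier
SmoothPoincare4 --since 2021 (30 rows, none singularity-theoretic), ledger negatives (0);
OpenAlex/S2/arXiv rate-limited, galaxy saturated (logged). Nearest prior art: SaekiSakuma1999 Rem
2.2 (existence of fold / fold+cusp maps Σ → S⁴ in every degree — the existence half, uncited by the
card) and EM97 (normal form); minimal-complexity questions for stable maps exist only between
surfaces. NOT FOUND: lens-depth or wrinkle number of degree-one maps Σ⁴ → S⁴, the chart-framed
unlinking lemma, the parking/clasp reduction, or any use of equidimensional wrinkles toward SPC4.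
Delta: known existence (EM97/SaekiSakuma) + Cerf–Palais recognitio  [refs: 10.1112/s0024610799007401, 10.1007/s002220050188, 10.1016/j.topol.2009.06.010, 1108.1265, 0802.0332, doi:10.1112/s0024610799007401, doi:10.1007/s002220050188, doi:10.1016/j.topol.2009.06.010, SaekiSakuma1999, BruceMond1999, Kirby1989, EliashbergMishachev1997]

Barriers (technique_class: singularity theory, equidimensional wrinkled maps): - technique_class: singularity theory, equidimensional wrinkled maps
- Literature.Barriers.SmoothPoincare4.TwistedSphereBarrierFour: USED positively (every recognition
ends in B⁴ ∪_φ B⁴ ≅ S⁴ via cerf_twistedSphere_four), never violated — one wrinkle can never present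
an exotic Σ, consistent with it.
- Literature.Barriers.SmoothPoincare4.LowGenusTrisectionBarrier: analogous graded statement for maps
to ℝ² (mz_genus_le_two_homotopySphere_gk); the depth ladder uses an S⁴ target and no central
surface; no rung is implied by or implies genus ≤ 2.
- Literature.Barriers.SmoothPoincare4.TopologicalBarrierFour: depth / wrinkle number are defined
through smooth maps of the given smooth structure, not functions of the homeomorphism type; the
blindness theorem does not apply formally (honest bet: they are also not computable; the value is
the rung theorems).
- Literature.Barriers.SmoothPoincare4.StableBarrierFour: no stabilisation by S²×S² or CP² anywhere;
depth is not claimed stable.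
- Literature.Barriers.SmoothPoincare4.HCobordismInvariantBarrierFour: depth is not an h-cobordism
invariant by construction; not engaged.
- Literature.Barriers.SmoothPoincare4.GaugeSumBarrierFour: no gauge-theoretic invariant used.
- Literature.Barriers.SmoothPoincare4.HCobordismBarrierFour: no h-cobordism ⇒ diffeomorphism step;
recognition is covering-space + Palais + Cerf.
- Literature.Barriers.SmoothPoincare4.PropertyTwoRBarrier: no handle slides / balanced
presentations; the card audit found no Andrews–

History (route lifecycle, newest last):
- 2026-08-15T16:13:33Z · rev 2: restated TwoWrinkleRung (stmt-SmoothPoincare4-4314), DepthTwoRung (stmt-SmoothPoincare4-4315), DepthTwoCollapse (stmt-SmoothPoincare4-4316), UnlinkingLemma (stmt-SmoothPoincare4-4317), WrinkledExistence (stmt-SmoothPoincare4-4318) — route-repair (glue.missing + cone guardrail; unit rbadge-SmoothPoincare4-Wrinkle (planner-rbadge-SmoothPoincare4-WrinkleUnlinkin-1fe27638-g4-0)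
- 2026-08-22T19:47:57Z · DORMANT — reconciler: no traction for 5.6 d (last activity item-evidence-added at 2026-08-17T04:30:35Z); parked, not closed — `ledger route dormant route-SmoothPoincare4- (operator:999:272774)

sub-problem: SmoothPoincare4 · status: dormant · opened planner-plancard-SmoothPoincare4-SmoothPoinca-a7f78889-0 2026-08-15T11:32:03Z · rev 2 · ledger route-SmoothPoincare4-WrinkleUnlinking
GENERATED by the gate from the ledger (D-0016/17). Provers cite these decls: `theorem foo : Summit.SmoothPoincare4.SmoothPoincare4.Theses.WrinkleUnlinking.<Decl> := …` in Summits/SmoothPoincare4/SmoothPoincare4/Theorems/<Name>.lean.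
-/

namespace Summit.SmoothPoincare4.SmoothPoincare4.Theses.WrinkleUnlinking

open scoped BigOperators Topology Manifold Classical MeasureTheory ProbabilityTheory Matrix InnerProductSpace ComplexConjugate ContinuousMap ContDiff
open Filter Set Function TopologicalSpace MeasureTheory

attribute [summit_statement] _root_.SmoothPoincare4

open Literature.SPC4

-- earlier TwoWrinkleRung (stmt-SmoothPoincare4-4314, replaced 2026-08-15T16:13:33Z -> stmt-SmoothPoincare4-10371): retired by None — ∀ (S : Literature.Topology.FourManifolds.HomotopySphere 4) (p : S.carrier → Metric.sphere (0 : EuclideanSpace ℝ (Fin 5)) 1) (k : ℕ) (D : Fin k → Set S.carrier), (ContMDiff (𝓡 4) (𝓡 4) ∞ p ∧ Pairwise (Function.onFun Disjoint D) ∧ (∀ x, x ∉ (⋃ i, D i) → IsLocalDiffeomorp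
/-- item stmt-SmoothPoincare4-10371 · crux · rank 2 · open · by planner
why it might fail: overlap cells of two chart balls in S⁴ can be Schoenflies-type fake balls or encode a Gluck twist, so the clasped-pair case may be as hard as those problems; no finite census of two-lens arrangements exists.
sources: EliashbergMishachev1997, Cerf1968, Palais1960
[crux] a homotopy 4-sphere carrying a degree-one wrinkled map to S⁴ with at most two wrinkles is
diffeomorphic to S⁴ (card rung "two overlapping wrinkles ⇒ standard"; by the parking argument it
reduces to one clasped pair over the cells of two overlapping cusped 3-spheres in S⁴). [deps:
UnlinkingLemma] [difficulty: XL] -/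
@[route_item "route-SmoothPoincare4-WrinkleUnlinking"]
def TwoWrinkleRung : Prop :=
  ∀ (M : Type) [TopologicalSpace M] [T2Space M] [SecondCountableTopology M] [ChartedSpace (EuclideanSpace ℝ (Fin 4)) M] [IsManifold (𝓡 4) ∞ M], (M ≃ₕ Metric.sphere (0 : EuclideanSpace ℝ (Fin 5)) 1) → ∀ (p : M → Metric.sphere (0 : EuclideanSpace ℝ (Fin 5)) 1) (k : ℕ) (D : Fin k → Set M), (ContMDiff (𝓡 4) (𝓡 4) ∞ p ∧ Pairwise (Function.onFun Disjoint D) ∧ (∀ x, x ∉ (⋃ i, D i) → IsLocalDiffeomorphAt (𝓡 4) (𝓡 4) ∞ p x) ∧ (∀ y, y ∉ (⋃ i, p '' (D i)) → ∃! x, p x = y) ∧ (∃ y, y ∉ ⋃ i, p '' (D i)) ∧ ∀ i, ∃ (U : Set M) (φ : M → EuclideanSpace ℝ (Fin 4)) (V : Set (Metric.sphere (0 : EuclideanSpace ℝ (Fin 5)) 1)) (ψ : (Metric.sphere (0 : EuclideanSpace ℝ (Fin 5)) 1) → EuclideanSpace ℝ (Fin 4)), IsOpen U ∧ D i ⊆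 U ∧ Set.InjOn φ U ∧ (∀ x ∈ U, IsLocalDiffeomorphAt (𝓡 4) (𝓡 4) ∞ φ x) ∧ φ '' (D i) = Metric.closedBall (0 : EuclideanSpace ℝ (Fin 4)) 1 ∧ IsOpen V ∧ p '' U ⊆ V ∧ Set.InjOn ψ V ∧ (∀ y ∈ V, IsLocalDiffeomorphAt (𝓡 4) (𝓡 4) ∞ ψ y) ∧ ∀ x ∈ U, ψ (p x) = WithLp.toLp 2 (fun j : Fin 4 => if j = 3 then (φ x 3) ^ 3 + 3 * ((φ x 0) ^ 2 + (φ x 1) ^ 2 + (φ x 2) ^ 2 - 1) * φ x 3 else φ x j)) → k ≤ 2 → Nonempty (M ≃ₘ⟮𝓡 4, 𝓡 4⟯ Metric.sphere (0 : EuclideanSpace ℝ (Fin 5)) 1)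

-- earlier DepthTwoRung (stmt-SmoothPoincare4-4315, replaced 2026-08-15T16:13:33Z -> stmt-SmoothPoincare4-10372): retired by None — ∀ (S : Literature.Topology.FourManifolds.HomotopySphere 4) (p : S.carrier → Metric.sphere (0 : EuclideanSpace ℝ (Fin 5)) 1) (k : ℕ) (D : Fin k → Set S.carrier), (ContMDiff (𝓡 4) (𝓡 4) ∞ p ∧ Pairwise (Function.onFun Disjoint D) ∧ (∀ x, x ∉ (⋃ i, D i) → IsLocalDiffeomorphA
/-- item stmt-SmoothPoincare4-10372 · crux · rank 3 · open · by planner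
why it might fail: depth 2 allows necklaces of pairwise clasped wrinkles around loops in S⁴, which may realise spun / twist-spun (Gluck) presentations; pairwise analysis need not globalise.
sources: EliashbergMishachev1997, SaekiSakuma1999, Cerf1968
[crux] a homotopy 4-sphere carrying a degree-one wrinkled map to S⁴ of lens depth ≤ 2 (no point of
S⁴ in three lens images) is diffeomorphic to S⁴; implies TwoWrinkleRung (proved in the sketch).
[deps: TwoWrinkleRung] [difficulty: open-problem] -/
@[route_item "route-SmoothPoincare4-WrinkleUnlinking", crux]
def DepthTwoRung : Prop :=
  ∀ (M : Type) [TopologicalSpace M] [T2Space M] [SecondCountableTopology M] [ChartedSpace (EuclideanSpace ℝ (Fin 4)) M] [IsManifold (𝓡 4) ∞ M], (M ≃ₕ Metric.sphere (0 : EuclideanSpace ℝ (Fin 5)) 1) → ∀ (p : M → Metric.sphere (0 : EuclideanSpace ℝ (Fin 5)) 1) (k : ℕ) (D : Fin k → Set M), (ContMDiff (𝓡 4) (𝓡 4) ∞ p ∧ Pairwise (Function.onFun Disjoint D) ∧ (∀ x, x ∉ (⋃ i, D i) → IsLocalDiffeomorphAt (𝓡 4) (𝓡 4) ∞ p x) ∧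 (∀ y, y ∉ (⋃ i, p '' (D i)) → ∃! x, p x = y) ∧ (∃ y, y ∉ ⋃ i, p '' (D i)) ∧ ∀ i, ∃ (U : Set M) (φ : M → EuclideanSpace ℝ (Fin 4)) (V : Set (Metric.sphere (0 : EuclideanSpace ℝ (Fin 5)) 1)) (ψ : (Metric.sphere (0 : EuclideanSpace ℝ (Fin 5)) 1) → EuclideanSpace ℝ (Fin 4)), IsOpen U ∧ D i ⊆ U ∧ Set.InjOn φ U ∧ (∀ x ∈ U, IsLocalDiffeomorphAt (𝓡 4) (𝓡 4) ∞ φ x) ∧ φ '' (D i) = Metric.closedBall (0 : EuclideanSpace ℝ (Fin 4)) 1 ∧ IsOpen V ∧ p '' U ⊆ V ∧ Set.InjOn ψ V ∧ (∀ y ∈ V, IsLocalDiffeomorphAt (𝓡 4) (𝓡 4) ∞ ψ y) ∧ ∀ x ∈ U, ψ (p x) = WithLp.toLp 2 (fun j : Fin 4 => if j = 3 then (φ x 3) ^ 3 + 3 * ((φ x 0) ^ 2 + (φ x 1) ^ 2 + (φ x 2) ^ 2 - 1) * φ x 3 else φ x j)) → (∀ (y : Metric.sphere (0 : EuclideanSpace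 ℝ (Fin 5)) 1) (i j l : Fin k), i ≠ j → j ≠ l → i ≠ l → ¬ (y ∈ p '' (D i) ∧ y ∈ p '' (D j) ∧ y ∈ p '' (D l))) → Nonempty (M ≃ₘ⟮𝓡 4, 𝓡 4⟯ Metric.sphere (0 : EuclideanSpace ℝ (Fin 5)) 1)

-- earlier DepthTwoCollapse (stmt-SmoothPoincare4-4316, replaced 2026-08-15T16:13:33Z -> stmt-SmoothPoincare4-10373): retired by None — ∀ S : Literature.Topology.FourManifolds.HomotopySphere 4, ∃ (p : S.carrier → Metric.sphere (0 : EuclideanSpace ℝ (Fin 5)) 1) (k : ℕ) (D : Fin k → Set S.carrier), (ContMDiff (𝓡 4) (𝓡 4) ∞ p ∧ Pairwise (Function.onFun Disjoint D) ∧ (∀ x, x ∉ (⋃ i, D i) → IsLocalDiffeom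
/-- item stmt-SmoothPoincare4-10373 · crux · rank 4 · open · by planner
why it might fail: no operation lowering depth is known (wrinkling raises complexity; parking only separates clean wrinkles); minimal depth may be ≥ 3 or unbounded on exotic spheres; evidence beyond SPC4 ⇒ it is nil.
sources: EliashbergMishachev1997, SaekiSakuma1999, Eliashberg1970
[crux] every homotopy 4-sphere admits a degree-one wrinkled map to S⁴ of lens depth ≤ 2 (the
complexity-collapse half; weaker than "≤ 2 wrinkles"). [difficulty: open-problem] -/
@[route_item "route-SmoothPoincare4-WrinkleUnlinking", crux]
def DepthTwoCollapse : Prop :=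
  ∀ (M : Type) [TopologicalSpace M] [T2Space M] [SecondCountableTopology M] [ChartedSpace (EuclideanSpace ℝ (Fin 4)) M] [IsManifold (𝓡 4) ∞ M], (M ≃ₕ Metric.sphere (0 : EuclideanSpace ℝ (Fin 5)) 1) → ∃ (p : M → Metric.sphere (0 : EuclideanSpace ℝ (Fin 5)) 1) (k : ℕ) (D : Fin k → Set M), (ContMDiff (𝓡 4) (𝓡 4) ∞ p ∧ Pairwise (Function.onFun Disjoint D) ∧ (∀ x, x ∉ (⋃ i, D i) → IsLocalDiffeomorphAt (𝓡 4) (𝓡 4) ∞ p x) ∧ (∀ y, y ∉ (⋃ i, p '' (D i)) → ∃! x, p x = y) ∧ (∃ y, y ∉ ⋃ i, p '' (D i)) ∧ ∀ i, ∃ (U : Set M) (φ : M → EuclideanSpace ℝ (Fin 4)) (V : Set (Metric.sphere (0 : EuclideanSpace ℝ (Fin 5)) 1)) (ψ : (Metric.sphere (0 : EuclideanSpace ℝ (Fin 5)) 1) → EuclideanSpace ℝ (Fin 4)), IsOpen U ∧ D i ⊆ U ∧ Set.InjOn φ U ∧ (∀ x ∈ U, IsLocalDiffeomorphAt (𝓡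 4) (𝓡 4) ∞ φ x) ∧ φ '' (D i) = Metric.closedBall (0 : EuclideanSpace ℝ (Fin 4)) 1 ∧ IsOpen V ∧ p '' U ⊆ V ∧ Set.InjOn ψ V ∧ (∀ y ∈ V, IsLocalDiffeomorphAt (𝓡 4) (𝓡 4) ∞ ψ y) ∧ ∀ x ∈ U, ψ (p x) = WithLp.toLp 2 (fun j : Fin 4 => if j = 3 then (φ x 3) ^ 3 + 3 * ((φ x 0) ^ 2 + (φ x 1) ^ 2 + (φ x 2) ^ 2 - 1) * φ x 3 else φ x j)) ∧ (∀ (y : Metric.sphere (0 : EuclideanSpace ℝ (Fin 5)) 1) (i j l : Fin k), i ≠ j → j ≠ l → i ≠ l → ¬ (y ∈ p '' (D i) ∧ y ∈ p '' (D j) ∧ y ∈ p '' (D l)))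

-- earlier UnlinkingLemma (stmt-SmoothPoincare4-4317, replaced 2026-08-15T16:13:33Z -> stmt-SmoothPoincare4-10374): retired by None — ∀ (S : Literature.Topology.FourManifolds.HomotopySphere 4) (p : S.carrier → Metric.sphere (0 : EuclideanSpace ℝ (Fin 5)) 1) (k : ℕ) (D : Fin k → Set S.carrier), (ContMDiff (𝓡 4) (𝓡 4) ∞ p ∧ Pairwise (Function.onFun Disjoint D) ∧ (∀ x, x ∉ (⋃ i, D i) → IsLocalDiffeomorp
/-- item stmt-SmoothPoincare4-10374 · support · rank 9 · open · by planner
sources: EliashbergMishachev1997, Palais1960, Cerf1968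
[support] depth ≤ 1 (lens images pairwise disjoint) ⇒ Σ ≅ S⁴: one sheet over the complement of the
lenses, full model packet ≅ B⁴ over a chart ball around each lens, Palais
(palais_ballComplement_sphere_four) + Cerf (cerf_twistedSphere_four as hypothesis if needed). The
base case of the ladder; implies the k ≤ 1 case of TwoWrinkleRung (proved in the sketch).
[difficulty: L] -/
@[route_item "route-SmoothPoincare4-WrinkleUnlinking"]
def UnlinkingLemma : Prop :=
  ∀ (M : Type) [TopologicalSpace M] [T2Space M] [SecondCountableTopology M] [ChartedSpace (EuclideanSpace ℝ (Fin 4)) M] [IsManifold (𝓡 4) ∞ M], (M ≃ₕ Metric.sphere (0 : EuclideanSpace ℝ (Fin 5)) 1) → ∀ (p : M → Metric.sphere (0 : EuclideanSpace ℝ (Fin 5)) 1) (k : ℕ) (D : Fin k → Set M), (ContMDiff (𝓡 4) (𝓡 4) ∞ p ∧ Pairwise (Function.onFun Disjoint D) ∧ (∀ x, x ∉ (⋃ i, D i) → IsLocalDiffeomorphAt (𝓡 4) (𝓡 4) ∞ p x) ∧ (∀ y, y ∉ (⋃ i, p '' (D i)) → ∃! x, p x = y) ∧ (∃ y, y ∉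 ⋃ i, p '' (D i)) ∧ ∀ i, ∃ (U : Set M) (φ : M → EuclideanSpace ℝ (Fin 4)) (V : Set (Metric.sphere (0 : EuclideanSpace ℝ (Fin 5)) 1)) (ψ : (Metric.sphere (0 : EuclideanSpace ℝ (Fin 5)) 1) → EuclideanSpace ℝ (Fin 4)), IsOpen U ∧ D i ⊆ U ∧ Set.InjOn φ U ∧ (∀ x ∈ U, IsLocalDiffeomorphAt (𝓡 4) (𝓡 4) ∞ φ x) ∧ φ '' (D i) = Metric.closedBall (0 : EuclideanSpace ℝ (Fin 4)) 1 ∧ IsOpen V ∧ p '' U ⊆ V ∧ Set.InjOn ψ V ∧ (∀ y ∈ V, IsLocalDiffeomorphAt (𝓡 4) (𝓡 4) ∞ ψ y) ∧ ∀ x ∈ U, ψ (p x) = WithLp.toLp 2 (fun j : Fin 4 => if j = 3 then (φ x 3) ^ 3 + 3 * ((φ x 0) ^ 2 + (φ x 1) ^ 2 + (φ x 2) ^ 2 - 1) * φ x 3 else φ x j)) → Pairwise (Function.onFun Disjoint fun i => p '' (D i)) → Nonempty (M ≃ₘ⟮𝓡 4, 𝓡 4⟯ Metric.sphere (0 : EuclideanSpace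 ℝ (Fin 5)) 1)

-- earlier WrinkledExistence (stmt-SmoothPoincare4-4318, replaced 2026-08-15T16:13:33Z -> stmt-SmoothPoincare4-10375): retired by None — ∀ S : Literature.Topology.FourManifolds.HomotopySphere 4, ∃ (p : S.carrier → Metric.sphere (0 : EuclideanSpace ℝ (Fin 5)) 1) (k : ℕ) (D : Fin k → Set S.carrier), (ContMDiff (𝓡 4) (𝓡 4) ∞ p ∧ Pairwise (Function.onFun Disjoint D) ∧ (∀ x, x ∉ (⋃ i, D i) → IsLocalDiffeo
/-- item stmt-SmoothPoincare4-10375 · support · rank 9 · open · by planner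
sources: EliashbergMishachev1997, SaekiSakuma1999
[support] every homotopy 4-sphere admits a degree-one wrinkled map to S⁴ (some k). CLAIM resting on
EliashbergMishachev1997 Thm "Wrinkled mappings" + Dold–Whitney (TΣ ≅ p*TS⁴) + the degree bookkeeping
(Σ minus the discs is connected, so all sheets over a depth-0 point have one sign); documents that
the arena is non-empty; provable once that theorem is vendored as a named fact (cite item filed) —
until then not staffed. [difficulty: XL] -/
@[route_item "route-SmoothPoincare4-WrinkleUnlinking"]
def WrinkledExistence : Prop :=
  ∀ (M : Type) [TopologicalSpace M] [T2Space M] [SecondCountableTopology M] [ChartedSpace (EuclideanSpace ℝ (Fin 4)) M] [IsManifold (𝓡 4) ∞ M], (M ≃ₕ Metric.sphere (0 : EuclideanSpace ℝ (Fin 5)) 1) → ∃ (p : M → Metric.sphere (0 : EuclideanSpace ℝ (Fin 5)) 1) (k : ℕ) (D : Fin k → Set M), (ContMDiff (𝓡 4) (𝓡 4) ∞ p ∧ Pairwise (Function.onFun Disjoint D) ∧ (∀ x, x ∉ (⋃ i, D i) → IsLocalDiffeomorphAt (𝓡 4) (𝓡 4) ∞ p x) ∧ (∀ y, y ∉ (⋃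 i, p '' (D i)) → ∃! x, p x = y) ∧ (∃ y, y ∉ ⋃ i, p '' (D i)) ∧ ∀ i, ∃ (U : Set M) (φ : M → EuclideanSpace ℝ (Fin 4)) (V : Set (Metric.sphere (0 : EuclideanSpace ℝ (Fin 5)) 1)) (ψ : (Metric.sphere (0 : EuclideanSpace ℝ (Fin 5)) 1) → EuclideanSpace ℝ (Fin 4)), IsOpen U ∧ D i ⊆ U ∧ Set.InjOn φ U ∧ (∀ x ∈ U, IsLocalDiffeomorphAt (𝓡 4) (𝓡 4) ∞ φ x) ∧ φ '' (D i) = Metric.closedBall (0 : EuclideanSpace ℝ (Fin 4)) 1 ∧ IsOpen V ∧ p '' U ⊆ V ∧ Set.InjOn ψ V ∧ (∀ y ∈ V, IsLocalDiffeomorphAt (𝓡 4) (𝓡 4) ∞ ψ y) ∧ ∀ x ∈ U, ψ (p x) = WithLp.toLp 2 (fun j : Fin 4 => if j = 3 then (φ x 3) ^ 3 + 3 * ((φ x 0) ^ 2 + (φ x 1) ^ 2 + (φ x 2) ^ 2 - 1) * φ x 3 else φ x j))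

/-- item stmt-SmoothPoincare4-4319 · support · rank 9 · open · by planner
sources: EliashbergMishachev1997
[support] sanity / non-vacuity of the inlined predicate for k = 1: the standard S⁴ carries a
degree-one wrinkled self-map with exactly one wrinkle (cut the polynomial model w off to the
identity far out and transport by stereographic charts). A refuter who cannot build it has found a
definition leak. [difficulty: provable-now] -/
@[route_item "route-SmoothPoincare4-WrinkleUnlinking"]
def OneWrinkleOnSphere : Prop :=
  ∃ (p : (Metric.sphere (0 : EuclideanSpace ℝ (Fin 5)) 1) → Metric.sphere (0 : EuclideanSpace ℝ (Fin 5)) 1) (D : Fin 1 → Set (Metric.sphere (0 : EuclideanSpace ℝ (Fin 5)) 1)), (ContMDiff (𝓡 4) (𝓡 4) ∞ p ∧ Pairwise (Function.onFun Disjoint D) ∧ (∀ x, x ∉ (⋃ i, D i) → IsLocalDiffeomorphAt (𝓡 4) (𝓡 4) ∞ p x) ∧ (∀ y, y ∉ (⋃ i, p '' (D i)) → ∃! x, p x = y) ∧ (∃ y, y ∉ ⋃ i, p '' (D i)) ∧ ∀ i, ∃ (U : Set (Metric.sphere (0 : EuclideanSpace ℝ (Fin 5)) 1)) (φ : (Metric.sphere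 (0 : EuclideanSpace ℝ (Fin 5)) 1) → EuclideanSpace ℝ (Fin 4)) (V : Set (Metric.sphere (0 : EuclideanSpace ℝ (Fin 5)) 1)) (ψ : (Metric.sphere (0 : EuclideanSpace ℝ (Fin 5)) 1) → EuclideanSpace ℝ (Fin 4)), IsOpen U ∧ D i ⊆ U ∧ Set.InjOn φ U ∧ (∀ x ∈ U, IsLocalDiffeomorphAt (𝓡 4) (𝓡 4) ∞ φ x) ∧ φ '' (D i) = Metric.closedBall (0 : EuclideanSpace ℝ (Fin 4)) 1 ∧ IsOpen V ∧ p '' U ⊆ V ∧ Set.InjOn ψ V ∧ (∀ y ∈ V, IsLocalDiffeomorphAt (𝓡 4) (𝓡 4) ∞ ψ y) ∧ ∀ x ∈ U, ψ (p x) = WithLp.toLp 2 (fun j : Fin 4 => if j = 3 then (φ x 3) ^ 3 + 3 * ((φ x 0) ^ 2 + (φ x 1) ^ 2 + (φ x 2) ^ 2 - 1) * φ x 3 else φ x j))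

/-- item stmt-SmoothPoincare4-4320 · assembly · rank 1 · open · by planner
sources: KervaireMilnor1963, EliashbergMishachev1997
[assembly] TwoWrinkleRung → DepthTwoRung → DepthTwoCollapse → SmoothPoincare4 -/
@[route_item "route-SmoothPoincare4-WrinkleUnlinking"]
def Assembly : Prop :=
  TwoWrinkleRung → DepthTwoRung → DepthTwoCollapse → SmoothPoincare4

/-! D-0027 §2.1 — DECIDING THEOREM (planner-authored via `route open/edit --closes-file`; by planner-rbadge-SmoothPoincare4-WrinkleUnlinkin-1fe27638-g4-0 2026-08-15T16:13:33Z):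
its hypotheses are this route's items and its conclusion the sub-problem Statement (glue_lint), and it elaborates with this file. -/

@[closes "route-SmoothPoincare4-WrinkleUnlinking"] theorem closes (hR : DepthTwoRung) (hC : DepthTwoCollapse) : _root_.SmoothPoincare4 := by
  intro M _ _ _ _ _ e
  obtain ⟨p, k, D, hW, hd⟩ := hC M e
  exact hR M e p k D hW hd

end Summit.SmoothPoincare4.SmoothPoincare4.Theses.WrinkleUnlinking
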